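import Summits.KontsevichZagierPeriods.KontsevichZagierPeriods.Theorems.HermiteRigidityIslandComplementBoxFiveTerm
import Summits.KontsevichZagierPeriods.KontsevichZagierPeriods.Theorems.HermiteRigidityIslandComplementBoxDuplication
import Summits.KontsevichZagierPeriods.KontsevichZagierPeriods.Theorems.HermiteRigidityReductionRigidityLandenRat

/-!
# `ReductionRigidity` (stmt-KontsevichZagierPeriods-3407), line `Sketch`, stub `stub_landenThirdNinth`:
# Landen's evaluation `Li₂(1/3) − Li₂(1/9)/6 = π²/18 − log²3/6` inside the calculus

Route `KontsevichZagierPeriods/HermiteRigidity`, crux `ReductionRigidity` (stmt-3407), growth line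
`bloch-suslin-rational-dilog`, worker stub `stub_landenThirdNinth`. With the box symbols
`D(w) = [□², w/(1 − w pq)]` (value `Li₂(w)`), `[□², 1/(N − pq)] = D(1/N)`, `[□², 2/(1 + pq)]`
(value `ζ(2)`) and `C_N = [□², 1/((N − p)(N − q))]` (value `log²(N/(N − 1))`), Landen's
(Ramanujan's) evaluation `Li₂(1/3) − Li₂(1/9)/6 = π²/18 − log²3/6` is the explicit INTEGER relation

  `6·[□², 1/(3 − pq)] − [□², 1/(9 − pq)] − 2·[□², 2/(1 + pq)] + 2·C₂ + 2·C₃ − C₄ ∈ KZ.relations`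

among box representations, for ANY representations on the closed square with the printed integrands.
It is assembled from four landed chains of moves of the Kontsevich–Zagier calculus:

* duplication at level `M = 3` (`stub_boxDuplication`): `D(1/9) ≡ 2D(1/3) + 2D(−1/3)`;
* Landen at the rational point `x = 1/4` (`stub_landenRat`): `2D(1/4) + 2D(−1/3) + C₄ ≡ 0`;
* Abel's five-term relation at `(1/2, 1/2)` (`stub_boxFiveTerm`):
  `2D(1/2) − D(1/4) − 2D(1/3) − C₃ ≡ 0`;
* Landen at level `N = 2` (`stub_boxLanden`): `2D(1/2) − [□², 2/(1 + pq)] + C₂ ≡ 0`;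

so that `6D(1/3) − D(1/9) ≡ 4D(1/3) − 2D(−1/3) ≡ 4D(1/3) + 2D(1/4) + C₄ ≡ 4D(1/2) − 2C₃ + C₄`
`≡ 2([2/(1 + pq)] − C₂) − 2C₃ + C₄`. The auxiliary representations `D(1/3)`, `D(1/2)`, `D(1/4)`,
`D(−1/3)` are regular rational functions on `□²` (`KZ.RFun`), the doubled integrands `2/(3 − pq)`,
`2/(3 + pq)`, `2/(2 − pq)` are their formal sums (`RFun.add`, `RFun.neg`, rule 1b), and the
bookkeeping is done on `χ`-values for an arbitrary additive `χ` killing `KZ.relations`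
(`landenThirdNinth_chi`), then specialised to the quotient map onto the formal period ring
`KZ.FormalPeriodRing = FormalRep ⧸ relations`.

References: M. Kontsevich, D. Zagier, *Periods* (2001), §1.2 rules (1)–(3)
[cite: KontsevichZagier2001, §1.2]; D. Zagier, *The dilogarithm function* (2007), Ch. I §1–2
[cite: Zagier2007Dilogarithm, Ch. I §2]. No definitions are introduced.
-/

noncomputable section

open MeasureTheory Set MvPolynomial

namespace Summit.KontsevichZagierPeriods.HermiteRigidity.ReductionRigidity

open Literature.NumberTheory.Transcendental
open Literature.NumberTheory.Transcendental.KZ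

/-! ## The four auxiliary regular rational functions on `□²` -/

/-- The integrands `1/(3 − pq)` (`D(1/3)`), `(1/2)/(1 − pq/2)` (`D(1/2)`), `(1/4)/(1 − pq/4)`
(`D(1/4)`) and `−1/(3 + pq)` (`D(−1/3)`) are regular rational functions on the closed square.
[cite: KontsevichZagier2001, §1.1] -/
theorem exists_rfun_landenThirdNinth : ∃ T₃ H₂ A₄ M₃ : RFun 2,
    (∀ x ∈ cube 2, T₃.fn x = 1 / (3 - x 0 * x 1)) ∧
    (∀ x ∈ cube 2, H₂.fn x = ((1 / 2 : ℚ) : ℝ) / (1 - ((1 / 2 : ℚ) : ℝ) * x 0 * x 1)) ∧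
    (∀ x ∈ cube 2, A₄.fn x = ((1 / 4 : ℚ) : ℝ) / (1 - ((1 / 4 : ℚ) : ℝ) * x 0 * x 1)) ∧
    (∀ x ∈ cube 2, M₃.fn x = -1 / (3 + x 0 * x 1)) := by
  have hT : ∀ x ∈ cube 2, aeval x (C 3 - X 0 * X 1 : MvPolynomial (Fin 2) ℚ) ≠ 0 := by
    intro x hx
    obtain ⟨-, -, -, -, -, h⟩ := landen_face_bounds hx
    simp only [map_sub, map_mul, aeval_C, aeval_X, eq_ratCast, Rat.cast_ofNat]
    apply ne_of_gt
    linarith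
  have hH : ∀ q : ℚ, 0 < q → q < 1 →
      ∀ x ∈ cube 2, aeval x (1 - C q * X 0 * X 1 : MvPolynomial (Fin 2) ℚ) ≠ 0 := by
    intro q hq hq₁ x hx
    simp only [map_sub, map_one, map_mul, aeval_C, aeval_X, eq_ratCast]
    exact (landenRat_face_pos hq hq₁ hx).1.ne'
  have hM : ∀ x ∈ cube 2, aeval x (C 3 + X 0 * X 1 : MvPolynomial (Fin 2) ℚ) ≠ 0 := by
    intro x hx
    obtain ⟨-, -, -, -, h, -⟩ := landen_face_bounds hx
    simp only [map_add, map_mul, aeval_C, aeval_X, eq_ratCast, Rat.cast_ofNat]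
    apply ne_of_gt
    linarith
  refine ⟨⟨1, _, hT⟩, ⟨C (1 / 2), _, hH (1 / 2) (by norm_num) (by norm_num)⟩,
    ⟨C (1 / 4), _, hH (1 / 4) (by norm_num) (by norm_num)⟩, ⟨C (-1), _, hM⟩,
    fun x _ => ?_, fun x _ => ?_, fun x _ => ?_, fun x _ => ?_⟩
  · simp only [RFun.fn_apply, map_one, map_sub, map_mul, aeval_C, aeval_X, eq_ratCast,
      Rat.cast_ofNat]
  · simp only [RFun.fn_apply, map_sub, map_one, map_mul, aeval_C, aeval_X, eq_ratCast]
  · simp only [RFun.fn_apply, map_sub, map_one, map_mul, aeval_C, aeval_X, eq_ratCast]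
  · simp only [RFun.fn_apply, map_add, map_mul, aeval_C, aeval_X, eq_ratCast, Rat.cast_ofNat,
      Rat.cast_neg, Rat.cast_one]

/-! ## The chain of relations, on `χ`-values -/

section Chi

variable {R : Type} [CommRing R] {χ : KZ.FormalRep →+ R}
variable (hrel : ∀ c ∈ KZ.relations, χ c = 0)
include hrel

/-- **Landen's evaluation at `1/3`, `1/9` as a chain of moves, `χ`-form**: for every additive `χ`
killing `KZ.relations`,
`6χ[□², 1/(3 − pq)] − χ[□², 1/(9 − pq)] − 2χ[□², 2/(1 + pq)] + 2χ[C₂] + 2χ[C₃] − χ[C₄] = 0`,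
an integer combination of duplication at level `3` (`stub_boxDuplication`), Landen at `x = 1/4`
(`stub_landenRat`), the five-term relation at `(1/2, 1/2)` (`stub_boxFiveTerm`) and Landen at
level `2` (`stub_boxLanden`). [cite: KontsevichZagier2001, §1.2 rules (1)–(3)] -/
theorem landenThirdNinth_chi (r₃ r₉ z c₂ c₃ c₄ : IntegralRep 2)
    (hr₃ : r₃.domain = cube 2) (hr₃i : EqOn r₃.integrand (fun p => 1 / (3 - p 0 * p 1)) (cube 2))
    (hr₉ : r₉.domain = cube 2) (hr₉i : EqOn r₉.integrand (fun p => 1 / (9 - p 0 * p 1)) (cube 2))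
    (hz : z.domain = cube 2) (hzi : EqOn z.integrand (fun p => 2 / (1 + p 0 * p 1)) (cube 2))
    (hc₂ : c₂.domain = cube 2)
    (hc₂i : EqOn c₂.integrand (fun p => 1 / ((2 - p 0) * (2 - p 1))) (cube 2))
    (hc₃ : c₃.domain = cube 2)
    (hc₃i : EqOn c₃.integrand (fun p => 1 / ((3 - p 0) * (3 - p 1))) (cube 2))
    (hc₄ : c₄.domain = cube 2)
    (hc₄i : EqOn c₄.integrand (fun p => 1 / ((4 - p 0) * (4 - p 1))) (cube 2)) :
    6 * χ (KZ.of r₃) - χ (KZ.of r₉) - 2 * χ (KZ.of z) + 2 * χ (KZ.of c₂) + 2 * χ (KZ.of c₃) -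
      χ (KZ.of c₄) = 0 := by
  obtain ⟨T₃, H₂, A₄, M₃, hT₃, hH₂, hA₄, hM₃⟩ := exists_rfun_landenThirdNinth
  have q20 : (0 : ℚ) < 1 / 2 := by norm_num
  have q21 : (1 / 2 : ℚ) < 1 := by norm_num
  have q40 : (0 : ℚ) < 1 / 4 := by norm_num
  have q41 : (1 / 4 : ℚ) < 1 := by norm_num
  -- (1) duplication at level `M = 3`: `[1/(9 − pq)] − [T₃ + T₃] + [−(M₃ + M₃)] ∈ relations`
  have dup : KZ.of r₉ - KZ.of (T₃.add T₃).rep + KZ.of ((M₃.add M₃).neg).rep ∈ KZ.relations := by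
    refine stub_boxDuplication 3 (by norm_num) r₉ (T₃.add T₃).rep ((M₃.add M₃).neg).rep hr₉
      (fun x hx => ?_) (RFun.rep_domain _) (fun x hx => ?_) (RFun.rep_domain _) (fun x hx => ?_)
    · rw [hr₉i hx]
      norm_num
    · rw [RFun.rep_integrand, RFun.fn_add hx, hT₃ x hx]
      push_cast
      ring
    · rw [RFun.rep_integrand, RFun.fn_neg, RFun.fn_add hx, hM₃ x hx]
      push_cast
      ring
  -- (2) Landen at `x = 1/4`: `2[A₄] + 2[M₃] + [c₄] ∈ relations`
  have lr : 2 • KZ.of A₄.rep + 2 • KZ.of M₃.rep + KZ.of c₄ ∈ KZ.relations := by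
    refine stub_landenRat (1 / 4) q40 q41 A₄.rep M₃.rep c₄ (RFun.rep_domain _) (fun x hx => ?_)
      (RFun.rep_domain _) (fun x hx => ?_) hc₄ (fun x hx => ?_)
    · rw [RFun.rep_integrand]
      exact hA₄ x hx
    · obtain ⟨-, -, -, -, h5, -⟩ := landen_face_bounds hx
      have hb : (((1 / 4) / ((1 / 4) - 1) : ℚ) : ℝ) = -1 / 3 := by norm_num
      rw [RFun.rep_integrand, hM₃ x hx]
      beta_reduce
      rw [hb, div_eq_div_iff (by apply ne_of_gt; linarith) (by apply ne_of_gt; linarith)]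
      ring
    · obtain ⟨-, h0, -, h1, -, -⟩ := landen_face_bounds hx
      have hq := landenRat_face_pos q40 q41 hx
      rw [hc₄i hx]
      beta_reduce
      rw [div_eq_div_iff (mul_pos (by linarith) (by linarith)).ne' (mul_pos hq.2.2.2.1 hq.2.1).ne']
      push_cast
      ring
  -- (3) five-term relation at `(1/2, 1/2)`: `[H₂] + [H₂] − [A₄] − [T₃] − [T₃] − [c₃] ∈ relations`
  have ft : KZ.of H₂.rep + KZ.of H₂.rep - KZ.of A₄.rep - KZ.of T₃.rep - KZ.of T₃.rep - KZ.of c₃ ∈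
      KZ.relations := by
    refine stub_boxFiveTerm (1 / 2) (1 / 2) q20 q21 q20 q21 H₂.rep H₂.rep A₄.rep T₃.rep T₃.rep c₃
      (RFun.rep_domain _) (fun x hx => ?_) (RFun.rep_domain _) (fun x hx => ?_)
      (RFun.rep_domain _) (fun x hx => ?_) (RFun.rep_domain _) (fun x hx => ?_)
      (RFun.rep_domain _) (fun x hx => ?_) hc₃ (fun x hx => ?_)
    · rw [RFun.rep_integrand]
      exact hH₂ x hx
    · rw [RFun.rep_integrand]
      exact hH₂ x hx
    · obtain ⟨-, -, -, -, -, h6⟩ := landen_face_bounds hx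
      rw [RFun.rep_integrand, hA₄ x hx]
      push_cast
      rw [div_eq_div_iff (by apply ne_of_gt; linarith) (by apply ne_of_gt; linarith)]
      ring
    · obtain ⟨-, -, -, -, -, h6⟩ := landen_face_bounds hx
      rw [RFun.rep_integrand, hT₃ x hx]
      push_cast
      rw [div_eq_div_iff (by apply ne_of_gt; linarith) (by apply ne_of_gt; linarith)]
      ring
    · obtain ⟨-, -, -, -, -, h6⟩ := landen_face_bounds hx
      rw [RFun.rep_integrand, hT₃ x hx]
      push_cast
      rw [div_eq_div_iff (by apply ne_of_gt; linarith) (by apply ne_of_gt; linarith)]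
      ring
    · obtain ⟨-, h0, -, h1, -, -⟩ := landen_face_bounds hx
      rw [hc₃i hx]
      push_cast
      rw [div_mul_div_comm, div_eq_div_iff (mul_pos (by linarith) (by linarith)).ne'
        (mul_pos (by linarith) (by linarith)).ne']
      ring
  -- (4) Landen at level `N = 2`: `[H₂ + H₂] − [z] + [c₂] ∈ relations`
  have lan : KZ.of (H₂.add H₂).rep - KZ.of z + KZ.of c₂ ∈ KZ.relations := by
    refine stub_boxLanden 2 le_rfl (H₂.add H₂).rep z c₂ (RFun.rep_domain _) (fun x hx => ?_) hz
      (fun x hx => ?_) hc₂ (fun x hx => ?_)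
    · obtain ⟨-, -, -, -, -, h6⟩ := landen_face_bounds hx
      rw [RFun.rep_integrand, RFun.fn_add hx, hH₂ x hx]
      push_cast
      rw [← add_div, div_eq_div_iff (by apply ne_of_gt; linarith)
        (by apply ne_of_gt; linarith)]
      ring
    · rw [hzi hx]
      norm_num
    · rw [hc₂i hx]
      norm_num
  -- (5) the given `[1/(3 − pq)]` is `[T₃]`
  have br : χ (KZ.of r₃) = χ (KZ.of T₃.rep) :=
    rfun_chi_of_eq hrel T₃ hr₃ fun x hx => by rw [hr₃i hx]; exact (hT₃ x hx).symm
  -- additivity of the formal sums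
  have a1 := RFun.chi_add hrel T₃ T₃
  have a2 := RFun.chi_add hrel M₃ M₃
  have a3 := RFun.chi_neg hrel (M₃.add M₃)
  have a4 := RFun.chi_add hrel H₂ H₂
  simp only [RFun.chi] at a1 a2 a3 a4
  have dup' := hrel _ dup
  have lr' := hrel _ lr
  have ft' := hrel _ ft
  have lan' := hrel _ lan
  simp only [map_add, map_sub, map_nsmul, nsmul_eq_mul, Nat.cast_ofNat] at dup' lr' ft' lan'
  linear_combination 6 * br - dup' - a1 + a3 - a2 - lr' + 2 * lan' - 2 * a4 - 2 * ft'

end Chi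

/-! ## The registered stub -/

/-- **Stub `stub_landenThirdNinth`** (worker stub W2d of crux `ReductionRigidity`, stmt-3407, line
`Sketch`, growth line `bloch-suslin-rational-dilog`): **Landen's evaluation
`Li₂(1/3) − Li₂(1/9)/6 = π²/18 − log²3/6` inside the Kontsevich–Zagier calculus**, as the integer
relation `6[□², 1/(3 − pq)] − [□², 1/(9 − pq)] − 2[□², 2/(1 + pq)] + 2[□², 1/((2 − p)(2 − q))]`
`+ 2[□², 1/((3 − p)(3 − q))] − [□², 1/((4 − p)(4 − q))] ∈ KZ.relations` for any representations on
the closed square with the printed integrands (values `6Li₂(1/3) − Li₂(1/9) − 2ζ(2) + 2log²2`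
`+ 2log²(3/2) − log²(4/3) = 0`): `landenThirdNinth_chi` for the quotient map onto the formal period
ring `FormalRep ⧸ relations`. [cite: Zagier2007Dilogarithm, Ch. I §2] -/
theorem stub_landenThirdNinth : ∀ (r₃ r₉ z c₂ c₃ c₄ : IntegralRep 2),
    r₃.domain = cube 2 → EqOn r₃.integrand (fun p => 1 / (3 - p 0 * p 1)) (cube 2) →
    r₉.domain = cube 2 → EqOn r₉.integrand (fun p => 1 / (9 - p 0 * p 1)) (cube 2) →
    z.domain = cube 2 → EqOn z.integrand (fun p => 2 / (1 + p 0 * p 1)) (cube 2) →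
    c₂.domain = cube 2 → EqOn c₂.integrand (fun p => 1 / ((2 - p 0) * (2 - p 1))) (cube 2) →
    c₃.domain = cube 2 → EqOn c₃.integrand (fun p => 1 / ((3 - p 0) * (3 - p 1))) (cube 2) →
    c₄.domain = cube 2 → EqOn c₄.integrand (fun p => 1 / ((4 - p 0) * (4 - p 1))) (cube 2) →
    6 • KZ.of r₃ - KZ.of r₉ - 2 • KZ.of z + 2 • KZ.of c₂ + 2 • KZ.of c₃ - KZ.of c₄ ∈ KZ.relations := by
  intro r₃ r₉ z c₂ c₃ c₄ hr₃ hr₃i hr₉ hr₉i hz hzi hc₂ hc₂i hc₃ hc₃i hc₄ hc₄i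
  have h := landenThirdNinth_chi
    (χ := (toFormalPeriod.toAddMonoidHom : FormalRep →+ FormalPeriodRing))
    (fun c hc => toFormalPeriod_eq_zero_of_mem hc) r₃ r₉ z c₂ c₃ c₄ hr₃ hr₃i hr₉ hr₉i hz hzi hc₂
    hc₂i hc₃ hc₃i hc₄ hc₄i
  rw [← toFormalPeriod_eq_zero_iff]
  simp only [map_sub, map_add, map_nsmul]
  simpa using h

end Summit.KontsevichZagierPeriods.HermiteRigidity.ReductionRigidity

end
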